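import Literature.AlgebraicGeometry.Resolution.ArithmeticalThreefoldsLocalDescentKummerStable
import HarnessLib

/-!
# The Kummer core of tame descent from a stable LOCAL RING ([CoP1] Lemma 9.4, "S is stable by G")

Topic: `Literature/AlgebraicGeometry/Resolution`. PROOF side of `CossartPiltant2019ReductionP`
(`ArithmeticalThreefoldsLocal.lean`), input (C4). `kummerCore_of_stableModel`
(`ArithmeticalThreefoldsLocalDescentKummerStable.lean`) proves the Kummer core of [CoP1]
Lemma 9.4 from a local uniformization `S[t] ⊆ O_E` of `N = A(θ)` whose GENERATING ALGEBRA
`S[t]` is stable under `Gal(N|A)`. The printed sentence (HAL p. 29) — "let `S` be a local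
uniformization of `W/k` … `S` is stable by `G`" — is about the LOCAL RING: in the climbing frame,
`(S[t])_𝔪`, the local ring at the centre of `O_E`. This file records that the weaker, printed
form suffices: if `(S[t])_𝔪` is `Gal(N|A)`-stable, the orbit algebra `S[τ t : τ ∈ Gal]` is a
`Gal(N|A)`-stable generating algebra with the SAME local ring (sandwich
`S[t] ⊆ S[Gal·t] ⊆ (S[t])_𝔪`), so `kummerCore_of_stableModel` applies.

* `exists_stableModel_of_stableLocalRing` — PROVED: a local uniformization of `N` whose local
  ring is `Gal(N|A)`-stable can be replaced by one whose generating `S`-algebra is stable;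
* `kummerCore_of_stableLocalRing` — PROVED: the Kummer core from a local uniformization with
  `Gal(N|A)`-stable local ring;
* `cossartPiltant2019ReductionP_of_cjs_of_stableLocalRing` — PROVED:
  `CossartPiltant2019Local → CossartPiltant2019Principalization → CossartJannsenSaito2020General →
  (embedded resolution of surfaces) → (hStabLoc: "S is stable by G") → (Prop. 9.3) →
  CossartPiltant2019ReductionP`.

Everything is PROVED; no named facts are introduced.

## Sources

* V. Cossart, O. Piltant, J. Algebra 320 (2008) 1051–1082: proof of Lemma 9.4 (HAL
  hal-00139124, p. 29, l. 16). [CossartPiltant2008]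
* V. Cossart, O. Piltant, J. Algebra 529 (2019) 268–535 = arXiv:1412.0868, proof of Prop. 4.10
  (arXiv v1: Prop. 4.8, p. 54). [CossartPiltant2019]
-/

noncomputable section

open CategoryTheory AlgebraicGeometry TopologicalSpace IsLocalRing _root_.Polynomial
  _root_.IntermediateField

namespace Literature.AlgebraicGeometry.Resolution

universe u

section StableLocalRing

variable {S E : Type u} [CommRing S] [Field E] [Algebra S E]

/-- **From a stable local ring to a stable model** ("`S` is stable by `G`", read on the local
ring `(S[t])_𝔪`): for a finite Galois `N | A` inside `E` (`A ∋ S`) and a model `S[t] ⊆ O_E`,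
`t ⊆ N ⊆ Frac(S)(t)`, regular at the centre whose LOCAL RING at the centre of `O_E` is stable
under `Gal(N|A)`, the orbit algebra `S[Gal(N|A)·t]` is a `Gal(N|A)`-stable model of `N` with
the same local ring, hence regular at the centre. [cite: CossartPiltant2008, proof of Lemma 9.4 (HAL p. 29)] -/
theorem exists_stableModel_of_stableLocalRing (OE : ValuationSubring E)
    (A : Subfield E) (hSA : ∀ s : S, algebraMap S E s ∈ A)
    (N : IntermediateField A E) [FiniteDimensional A N]
    (t : Finset E) (htN : (t : Set E) ⊆ N.toSubfield)
    (hNcl : N.toSubfield ≤ Subfield.closure (Set.range (algebraMap S E) ∪ (t : Set E)))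
    (hTO : (Algebra.adjoin S (t : Set E)).toSubring ≤ OE.toSubring)
    (hreg : IsRegularLocalRing (Localization.AtPrime
      (Ideal.comap (Subring.inclusion hTO) (maximalIdeal OE))))
    (hstab : ∀ (τ : N ≃ₐ[A] N) (x : N),
      (x : E) ∈ locAtCentre (Algebra.adjoin S (t : Set E)).toSubring OE →
      ((τ x : N) : E) ∈ locAtCentre (Algebra.adjoin S (t : Set E)).toSubring OE) :
    ∃ t' : Finset E, (t' : Set E) ⊆ N.toSubfield ∧
      N.toSubfield ≤ Subfield.closure (Set.range (algebraMap S E) ∪ (t' : Set E)) ∧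
      ∃ hTO' : (Algebra.adjoin S (t' : Set E)).toSubring ≤ OE.toSubring,
        IsRegularLocalRing (Localization.AtPrime
          (Ideal.comap (Subring.inclusion hTO') (maximalIdeal OE))) ∧
        ∀ (τ : N ≃ₐ[A] N) (x : N), (x : E) ∈ Algebra.adjoin S (t' : Set E) →
          ((τ x : N) : E) ∈ Algebra.adjoin S (t' : Set E) := by
  classical
  have htN' : ∀ x ∈ t, x ∈ N := fun x hx => htN (Finset.mem_coe.mpr hx)
  let t₀ : Finset N := t.subtype (· ∈ N)
  have ht₀ : ∀ y : N, y ∈ t₀ ↔ (y : E) ∈ t := fun y => Finset.mem_subtype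
  -- the orbit `Gal·t`
  let t' : Finset E :=
    (Finset.univ : Finset (N ≃ₐ[A] N)).biUnion fun τ => t₀.image fun y => ((τ y : N) : E)
  have ht' : ∀ x : E, x ∈ t' ↔ ∃ (τ : N ≃ₐ[A] N) (y : N), (y : E) ∈ t ∧ ((τ y : N) : E) = x := by
    intro x
    simp only [t', Finset.mem_biUnion, Finset.mem_univ, true_and, Finset.mem_image]
    constructor
    · rintro ⟨τ, y, hy, rfl⟩
      exact ⟨τ, y, (ht₀ y).mp hy, rfl⟩
    · rintro ⟨τ, y, hy, rfl⟩
      exact ⟨τ, y, (ht₀ y).mpr hy, rfl⟩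
  have htt' : t ⊆ t' := by
    intro x hx
    exact (ht' x).mpr ⟨1, ⟨x, htN' x hx⟩, hx, rfl⟩
  set L := locAtCentre (Algebra.adjoin S (t : Set E)).toSubring OE with hL
  have hLO : L ≤ OE.toSubring := locAtCentre_le hTO
  have htL : ∀ x ∈ t, x ∈ L := fun x hx =>
    le_locAtCentre _ OE (Algebra.subset_adjoin (Finset.mem_coe.mpr hx))
  have ht'L : ∀ x ∈ t', x ∈ L := by
    intro x hx
    obtain ⟨τ, y, hy, rfl⟩ := (ht' x).mp hx
    exact hstab τ y (htL _ hy)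
  -- the sandwich `S[t] ⊆ S[t′] ⊆ (S[t])_𝔪`
  have hle₁ : (Algebra.adjoin S (t : Set E)).toSubring ≤ (Algebra.adjoin S (t' : Set E)).toSubring :=
    fun x hx => Algebra.adjoin_mono (by exact_mod_cast htt') hx
  have hle₂ : (Algebra.adjoin S (t' : Set E)).toSubring ≤ L := by
    rw [Algebra.adjoin_eq_ring_closure]
    refine Subring.closure_le.mpr ?_
    rintro x (⟨s, rfl⟩ | hx)
    · exact le_locAtCentre _ OE (Subalgebra.algebraMap_mem _ s)
    · exact ht'L x (Finset.mem_coe.mp hx)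
  have hTO' : (Algebra.adjoin S (t' : Set E)).toSubring ≤ OE.toSubring := hle₂.trans hLO
  have hloc : locAtCentre (Algebra.adjoin S (t' : Set E)).toSubring OE = L := by
    apply le_antisymm
    · exact (locAtCentre_mono OE hle₂).trans (locAtCentre_locAtCentre _ OE).le
    · exact locAtCentre_mono OE hle₁
  refine ⟨t', ?_, ?_, hTO', ?_, ?_⟩
  · intro x hx
    obtain ⟨τ, y, -, rfl⟩ := (ht' x).mp (Finset.mem_coe.mp hx)
    exact (τ y).2
  · exact hNcl.trans (Subfield.closure_mono (Set.union_subset_union_right _ (by exact_mod_cast htt')))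
  · refine (isRegularLocalRing_locAtCentre_iff hTO').mp ?_
    rw [hloc]
    exact (isRegularLocalRing_locAtCentre_iff hTO).mpr hreg
  · -- stability of `S[t′]`: pull back to `N` and argue on generators
    intro τ
    let ι : N →+* E := algebraMap N E
    let T' : Subring N := (Algebra.adjoin S (t' : Set E)).toSubring.comap ι
    have hmemT' : ∀ x : N, x ∈ T' ↔ (x : E) ∈ Algebra.adjoin S (t' : Set E) := fun _ => Iff.rfl
    -- `T′` is generated by `S` and the orbit, all inside `N`
    let φ : S →+* N := (algebraMap A N).comp ((algebraMap S E).codRestrict A hSA)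
    have hφ : ∀ s : S, ((φ s : N) : E) = algebraMap S E s := fun _ => rfl
    let t₁ : Finset N := t'.subtype (· ∈ N)
    have ht₁ : ∀ y : N, y ∈ t₁ ↔ (y : E) ∈ t' := fun y => Finset.mem_subtype
    have hgen : T' = Subring.closure (Set.range φ ∪ ↑t₁) := by
      apply le_antisymm
      · intro x hx
        have hx' : (x : E) ∈ (Algebra.adjoin S (t' : Set E)).toSubring := hx
        -- `S[t′] = ι (closure (range φ ∪ t₁))`
        have hsub : (Algebra.adjoin S (t' : Set E)).toSubring ≤
            (Subring.closure (Set.range φ ∪ ↑t₁)).map ι := by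
          rw [Algebra.adjoin_eq_ring_closure, RingHom.map_closure]
          refine Subring.closure_mono ?_
          rintro z (⟨s, rfl⟩ | hz)
          · exact ⟨φ s, Or.inl ⟨s, rfl⟩, hφ s⟩
          · have hzN : z ∈ N := by
              obtain ⟨τ', y, -, rfl⟩ := (ht' z).mp (Finset.mem_coe.mp hz)
              exact (τ' y).2
            exact ⟨⟨z, hzN⟩, Or.inr (Finset.mem_coe.mpr ((ht₁ _).mpr (Finset.mem_coe.mp hz))), rfl⟩
        obtain ⟨y, hy, hyx⟩ := hsub hx'
        have : y = x := (algebraMap N E).injective hyx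
        rw [← this]
        exact hy
      · refine Subring.closure_le.mpr ?_
        rintro x (⟨s, rfl⟩ | hx)
        · change ((φ s : N) : E) ∈ Algebra.adjoin S (t' : Set E)
          rw [hφ]
          exact Subalgebra.algebraMap_mem _ s
        · change (x : E) ∈ Algebra.adjoin S (t' : Set E)
          exact Algebra.subset_adjoin ((ht₁ x).mp (Finset.mem_coe.mp hx))
    -- `τ` maps the generators into `T′`
    have hτT' : T' ≤ T'.comap τ.toRingEquiv.toRingHom := by
      rw [hgen]
      refine Subring.closure_le.mpr ?_
      rintro x (⟨s, rfl⟩ | hx)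
      · refine Subring.mem_comap.mpr ?_
        change τ (φ s) ∈ Subring.closure (Set.range φ ∪ ↑t₁)
        rw [show τ (φ s) = φ s from τ.commutes _]
        exact Subring.subset_closure (Or.inl ⟨s, rfl⟩)
      · refine Subring.mem_comap.mpr ?_
        change τ x ∈ Subring.closure (Set.range φ ∪ ↑t₁)
        refine Subring.subset_closure (Or.inr (Finset.mem_coe.mpr ((ht₁ _).mpr ?_)))
        obtain ⟨τ', y, hy, hyx⟩ := (ht' (x : E)).mp ((ht₁ x).mp (Finset.mem_coe.mp hx))
        have hx' : x = τ' y := Subtype.ext hyx.symm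
        refine (ht' _).mpr ⟨τ * τ', y, hy, ?_⟩
        rw [hx', AlgEquiv.mul_apply]
    intro x hx
    have h1 : x ∈ T' := (hmemT' x).mpr hx
    have h2 := hτT' h1
    exact (hmemT' _).mp (Subring.mem_comap.mp h2)

variable [IsRegularLocalRing S]

/-- **The Kummer core of [CoP1] Lemma 9.4 from a local uniformization whose LOCAL RING is stable
by `Gal(N|A)`** ("`S` is stable by `G`", HAL p. 29): `kummerCore_of_stableModel` composed with
`exists_stableModel_of_stableLocalRing`. [cite: CossartPiltant2008, proof of Lemma 9.4 (HAL p. 29)] -/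
theorem kummerCore_of_stableLocalRing [IsAlgClosed E] [Algebra.IsAlgebraic S E]
    (p : ℕ) (hp : p.Prime) (hSchar : CharP (ResidueField S) p)
    (hSuc : IsUniversallyCatenaryRing S) (hinj : Function.Injective (algebraMap S E))
    (OE : ValuationSubring E) (hSO : ∀ s : S, algebraMap S E s ∈ OE)
    (hdom : ∀ s ∈ maximalIdeal S, OE.valuation (algebraMap S E s) < 1)
    (hres : ∀ y : OE, ∃ q : S[X], (∃ i, q.coeff i ∉ maximalIdeal S) ∧
      OE.valuation (q.eval₂ (algebraMap S E) y) < 1)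
    {ℓ : ℕ} (hℓ : ℓ.Prime) (hℓp : ℓ ≠ p) {ζ : E} (hζ : IsPrimitiveRoot ζ ℓ)
    (A : Subfield E) (hSA : ∀ s : S, algebraMap S E s ∈ A) (hζA : ζ ∈ A) (θ : E)
    (hfin : Module.finrank A (adjoin A ({θ} : Set E)) = ℓ) [IsGalois A (adjoin A ({θ} : Set E))]
    (htop : inertiaGroupIn OE (adjoin A ({θ} : Set E)) = ⊤)
    (hStabLoc : ∃ t : Finset E, (t : Set E) ⊆ (adjoin A ({θ} : Set E)).toSubfield ∧
      (adjoin A ({θ} : Set E)).toSubfield ≤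
        Subfield.closure (Set.range (algebraMap S E) ∪ (t : Set E)) ∧
      ∃ hTO : (Algebra.adjoin S (t : Set E)).toSubring ≤ OE.toSubring,
        IsRegularLocalRing (Localization.AtPrime
          (Ideal.comap (Subring.inclusion hTO) (maximalIdeal OE))) ∧
        ∀ (τ : adjoin A ({θ} : Set E) ≃ₐ[A] adjoin A ({θ} : Set E)) (x : adjoin A ({θ} : Set E)),
          (x : E) ∈ locAtCentre (Algebra.adjoin S (t : Set E)).toSubring OE →
          ((τ x : adjoin A ({θ} : Set E)) : E) ∈
            locAtCentre (Algebra.adjoin S (t : Set E)).toSubring OE) :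
    ∃ t : Finset E, (t : Set E) ⊆ A ∧
      A ≤ Subfield.closure (Set.range (algebraMap S E) ∪ (t : Set E)) ∧
      ∃ hTO : (Algebra.adjoin S (t : Set E)).toSubring ≤ OE.toSubring,
        IsRegularLocalRing (Localization.AtPrime
          (Ideal.comap (Subring.inclusion hTO) (maximalIdeal OE))) := by
  haveI : FiniteDimensional A (adjoin A ({θ} : Set E)) :=
    Module.finite_of_finrank_pos (by rw [hfin]; exact hℓ.pos)
  obtain ⟨t, htN, hNcl, hTO, hreg, hstab⟩ := hStabLoc
  obtain ⟨t', htN', hNcl', hTO', hreg', hstab'⟩ :=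
    exists_stableModel_of_stableLocalRing OE A hSA (adjoin A ({θ} : Set E)) t htN hNcl hTO hreg hstab
  exact kummerCore_of_stableModel p hp hSchar hSuc hinj OE hSO hdom hres hℓ hℓp hζ A hSA hζA θ hfin
    htop ⟨t', htN', hNcl', hTO', hreg', hstab'⟩

end StableLocalRing

/-! ## The reduction with the stabilisation hypothesis in its printed (local-ring) form -/

/-- **Cossart–Piltant 2019, Prop. 4.10 from Thm. 1.5, principalization, resolution of excellent
surfaces, unramified descent and the printed sentence "`S` is stable by `G`"**:
`cossartPiltant2019ReductionP_of_cjs_of_kummer` with its Kummer core discharged by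
`kummerCore_of_stableLocalRing`. `hStabLoc`: in a totally ramified Kummer step `N = A(θ) | A`
of prime degree `ℓ ≠ p` (`ζ_ℓ ∈ A`), a local uniformization of the valuation on `N` may be
replaced by one whose LOCAL RING at the centre is stable under `Gal(N|A)` ([CoP1] proof of
Lemma 9.4, HAL p. 29: "let `S` be a local uniformization of `W/k` … `S` is stable by `G`,
since any conjugate of `S` is dominated by `W`, hence equal to `S`" — the one step of the
printed proof without proof in print); `hUnram`: [CoP1] Prop. 9.3.
[cite: CossartPiltant2019, Props. 4.3, 4.4 and proof of Prop. 4.10 (arXiv v1: Props. 4.2, 4.3, 4.8, pp. 50–54)]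
[cite: CossartPiltant2008, Lemma 9.4, Prop. 9.3, Prop. 9.5 (HAL pp. 26–30)]
[cite: CossartJannsenSaito2020, Thm. 1.2, Cor. 1.5] -/
theorem cossartPiltant2019ReductionP_of_cjs_of_stableLocalRing
    (hloc : CossartPiltant2019Local.{u}) (h44 : CossartPiltant2019Principalization.{u})
    (hCJS : CossartJannsenSaito2020General.{u})
    (hEmb : ∀ (Z : Scheme.{u}) [IsIntegral Z] [IsNoetherian Z], Scheme.IsRegular Z →
      Scheme.IsExcellent Z → ∀ (X : Set Z), IsClosed X → X ≠ Set.univ → topologicalKrullDim X ≤ 2 →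
        ∃ (Z' : Scheme.{u}) (π : Z' ⟶ Z), IsProper π ∧ Function.Surjective π.base ∧
          (∃ U : Z.Opens, (U : Set Z) = Xᶜ ∧ IsIso (π ∣_ U)) ∧
          IsStrictNormalCrossingsDivisor Z' (π.base ⁻¹' X))
    (hStabLoc :
      ∀ (p : ℕ), p.Prime →
      ∀ (S : Type u) [CommRing S] [IsDomain S] [IsRegularLocalRing S],
        IsExcellentRing S → ringKrullDim S = 3 → CharP (ResidueField S) p →
        IsAdicComplete (maximalIdeal S) S →
      ∀ (E : Type u) [Field E] [Algebra S E], Function.Injective (algebraMap S E) →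
        IsAlgClosed E → Algebra.IsAlgebraic S E →
      ∀ (OE : ValuationSubring E), (∀ s : S, algebraMap S E s ∈ OE) →
        (∀ s ∈ maximalIdeal S, OE.valuation (algebraMap S E s) < 1) →
        (∀ y : OE, ∃ q : S[X], (∃ i, q.coeff i ∉ maximalIdeal S) ∧
          OE.valuation (q.eval₂ (algebraMap S E) y) < 1) →
      Nonempty OE.valuation.RankOne →
      ∀ (ℓ : ℕ), ℓ.Prime → ℓ ≠ p → ∀ (ζ : E), IsPrimitiveRoot ζ ℓ →
      ∀ (A : Subfield E), (∀ s : S, algebraMap S E s ∈ A) → ζ ∈ A →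
      ∀ (θ : E), θ ∉ A → θ ^ ℓ ∈ A → OE.valuation θ ≤ 1 →
        Module.finrank A (adjoin A ({θ} : Set E)) = ℓ → IsGalois A (adjoin A ({θ} : Set E)) →
        inertiaGroupIn OE (adjoin A ({θ} : Set E)) = ⊤ →
        (∃ t : Finset E, (t : Set E) ⊆ (adjoin A ({θ} : Set E)).toSubfield ∧
          (adjoin A ({θ} : Set E)).toSubfield ≤
            Subfield.closure (Set.range (algebraMap S E) ∪ (t : Set E)) ∧
          ∃ hTO : (Algebra.adjoin S (t : Set E)).toSubring ≤ OE.toSubring,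
            IsRegularLocalRing (Localization.AtPrime
              (Ideal.comap (Subring.inclusion hTO) (maximalIdeal OE)))) →
        (∃ t : Finset E, (t : Set E) ⊆ (adjoin A ({θ} : Set E)).toSubfield ∧
          (adjoin A ({θ} : Set E)).toSubfield ≤
            Subfield.closure (Set.range (algebraMap S E) ∪ (t : Set E)) ∧
          ∃ hTO : (Algebra.adjoin S (t : Set E)).toSubring ≤ OE.toSubring,
            IsRegularLocalRing (Localization.AtPrime
              (Ideal.comap (Subring.inclusion hTO) (maximalIdeal OE))) ∧
            ∀ (τ : adjoin A ({θ} : Set E) ≃ₐ[A] adjoin A ({θ} : Set E))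
              (x : adjoin A ({θ} : Set E)),
              (x : E) ∈ locAtCentre (Algebra.adjoin S (t : Set E)).toSubring OE →
              ((τ x : adjoin A ({θ} : Set E)) : E) ∈
                locAtCentre (Algebra.adjoin S (t : Set E)).toSubring OE))
    (hUnram :
      ∀ (p : ℕ), p.Prime →
      ∀ (S : Type u) [CommRing S] [IsDomain S] [IsRegularLocalRing S],
        IsExcellentRing S → ringKrullDim S = 3 → CharP (ResidueField S) p →
        IsAdicComplete (maximalIdeal S) S →
      ∀ (E : Type u) [Field E] [Algebra S E], Function.Injective (algebraMap S E) →
        IsAlgClosed E → Algebra.IsAlgebraic S E →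
      ∀ (OE : ValuationSubring E), (∀ s : S, algebraMap S E s ∈ OE) →
        (∀ s ∈ maximalIdeal S, OE.valuation (algebraMap S E s) < 1) →
        (∀ y : OE, ∃ q : S[X], (∃ i, q.coeff i ∉ maximalIdeal S) ∧
          OE.valuation (q.eval₂ (algebraMap S E) y) < 1) →
      Nonempty OE.valuation.RankOne →
      ∀ (M : Subfield E), (∀ s : S, algebraMap S E s ∈ M) →
      ∀ (N : IntermediateField M E) [FiniteDimensional M N] [IsGalois M N] (K' : Subfield E),
        M ≤ K' → K' ≤ (lift (fixedField (inertiaGroupIn OE N))).toSubfield →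
        (∃ t : Finset E, (t : Set E) ⊆ K' ∧
          K' ≤ Subfield.closure (Set.range (algebraMap S E) ∪ (t : Set E)) ∧
          ∃ hTO : (Algebra.adjoin S (t : Set E)).toSubring ≤ OE.toSubring,
            IsRegularLocalRing (Localization.AtPrime
              (Ideal.comap (Subring.inclusion hTO) (maximalIdeal OE)))) →
        (∃ t : Finset E, (t : Set E) ⊆ M ∧
          M ≤ Subfield.closure (Set.range (algebraMap S E) ∪ (t : Set E)) ∧
          ∃ hTO : (Algebra.adjoin S (t : Set E)).toSubring ≤ OE.toSubring,
            IsRegularLocalRing (Localization.AtPrime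
              (Ideal.comap (Subring.inclusion hTO) (maximalIdeal OE))))) :
    CossartPiltant2019ReductionP.{u} :=
  cossartPiltant2019ReductionP_of_cjs_of_kummer hloc h44 hCJS hEmb
    (fun p hp S _ _ _ hS hSdim hSchar hScomp E _ _ hinj hE halg OE hSO hdom hres hrk ℓ hℓ hℓp ζ hζ A
        hSA hζA θ hθA hθℓ hvθ hfin hgal htop hLU => by
      haveI := hE
      haveI := halg
      haveI := hgal
      exact kummerCore_of_stableLocalRing p hp hSchar hS.isUniversallyCatenaryRing hinj OE hSO hdom
        hres hℓ hℓp hζ A hSA hζA θ hfin htop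
        (hStabLoc p hp S hS hSdim hSchar hScomp E hinj hE halg OE hSO hdom hres hrk ℓ hℓ hℓp ζ hζ A hSA
          hζA θ hθA hθℓ hvθ hfin hgal htop hLU))
    hUnram

end Literature.AlgebraicGeometry.Resolution

end
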